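import Summits.Ventures.PercRepro.RankLevelSetDepCountMult
import Summits.Ventures.PercRepro.RankLevelSetLevelSevenArithMult4H
import Summits.Ventures.PercRepro.RankLevelSetLevelSevenCapT
import Summits.Ventures.PercRepro.S1FourCircuitCount
import Summits.Ventures.PercRepro.RankLevelSetPlaneSix
import Summits.Ventures.PercRepro.RankLevelSetLevelSixCapT

/-!
# PercRepro — THEOREM C₇, CAP + LEMMA T + MULTIPLICITY + LEMMA T4: C-025 AT LEVEL `7` FOR EVERY FINITE MATROID AND
EVERY `p ≥ 651`, GIVEN LEVEL `6` FROM `650` (p9, S4)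

`proofs/SUBCLAIM-S4-p9.md` §S4.1 (d). The level-`7` assembly of `RankLevelSetLevelSevenCapT` with night-1's
MULTIPLICITY lever (`ncard_eRk_eq_ncard_eq_mul_le`, RankLevelSetDepCountMult: a dependent rank-`q` set of `m` elements
is reached from at least `m − q` pairs `(C, B′)`, so the level-`m` count carries the factor `m − q`) summed over the
sizes `8 ≤ m ≤ d` (`ncard_eRk_eq_ncard_le_le_sum`): the fibre sums become `σ^mult = Σ_j C(·, j)/(j + 1)` — with the
nullity cap `f = min 87 (7 + d)`, `f′ = min 43 (6 + d)`, Lemma T `s₃ ≤ d(d + 1)/2` and p2's LEMMA T4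
(`S1.three_mul_ncard_four_circuits_le`, S1FourCircuitCount: `3·s₄ ≤ d(d + 1)(d + 2)` on the core, lines `≤ 3` and
planes `≤ 6` points), the polynomial inequalities `level_seven_poly_mult4` (`RankLevelSetLevelSevenArithMult4A … H`, in
`ℚ`) hold from `p ≥ 650` (binding corank `d = 80`, the big class; `649` fails there) — p8's level-`6` recipe
(`RankLevelSetLevelSixMult4`, `P(6) = 255`) at level `7`:
`c025_core_seven_bounded_corank_mult4` (corank `8 … 95`, `p ≥ 650`), `c025_seven_of_six_mult4` (level `6` for all
`p ≥ 650` ⇒ level `7` for all `p ≥ 651`) and, over the tree as it stands (night-1's split row `c025_six_large_split`,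
level `6` for `p ≥ 1225`), the unconditional `c025_seven_large_mult4' : 1226 ≤ p → RLS M p 7`, and — composing p8's
`c025_six_of_five_capT` (level `5` from `468` ⇒ level `6` from `469`, RankLevelSetLevelSixCapT) with night-1's split row
`c025_five_large_split` (level `5` for `p ≥ 175`) — the UNCONDITIONAL `c025_seven_large_mult4'' : 651 ≤ p → RLS M p 7`.
Adapted from p8's RankLevelSetLevelSixMult4.lean (their text up to the level-`7` constants).
Axioms: standard.
-/

open scoped Matroid

namespace PercRepro

namespace ThmN

open Set

variable {α : Type}

/-- **The `e`-free core at level `7`, corank `8 ≤ d ≤ 95`, rank `p ≥ 650`** (split count, nullity cap, Lemma T,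
multiplicity, Lemma T4). -/
theorem c025_core_seven_bounded_corank_mult4 (M : Matroid α) [M.Finite] (p d : ℕ) (hp : 650 ≤ p) (hd8 : 8 ≤ d)
    (hd95 : d ≤ 95) (hR : M.eRank = (p : ℕ∞)) (hn : M.E.ncard = p + d)
    (hfree : ∀ e ∈ M.E, ∃ A ⊆ M.E \ {e}, e ∉ M.closure A ∧ e ∉ M.closure ((M.E \ {e}) \ A)) :
    RLS M p 7 := by
  classical
  have hEcard : M.ground_finite.toFinset.card = p + d := by
    rw [← Set.ncard_eq_toFinset_card _ M.ground_finite]; exact hn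
  -- the core is simple: every circuit has `≥ 3` elements
  have hL : ∀ e ∈ M.E, ¬ M.IsLoop e := not_isLoop_of_free M hfree
  have hs : ∀ e ∈ M.E, ∀ f ∈ M.E, e ≠ f → M.eRk {e, f} = 2 := by
    intro e he f hf hef
    have h2 : (2 : ℕ∞) ≤ M.eRk {e, f} :=
      two_le_eRk_of_two_le_ncard_of_free M hfree (pair_subset he hf) (by rw [ncard_pair hef])
    have h3 : M.eRk {e, f} ≤ 2 := by
      have := M.eRk_le_encard {e, f}
      rwa [encard_pair hef] at this
    exact le_antisymm h3 h2
  have hcirc : ∀ C, M.IsCircuit C → 3 ≤ C.encard := three_le_encard_of_circuit M hL hs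
  have hd : M.E.encard = M.eRank + d := by
    rw [hR, ← M.ground_finite.cast_ncard_eq, hn]
    push_cast
    ring
  -- the nullity cap: every `X ⊆ E` has `|X| ≤ r(X) + d`
  have hcap : ∀ X ⊆ M.E, ∀ k : ℕ, M.eRk X ≤ k → X.ncard ≤ k + d := by
    intro X hX k hr
    have h1 := Matroid.encard_le_eRk_add_of_encard_eq hX hd
    have h2 : X.encard ≤ (k : ℕ∞) + d := h1.trans (by gcongr)
    have hfin : X.Finite := M.ground_finite.subset hX
    rw [← hfin.cast_ncard_eq] at h2
    exact_mod_cast h2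
  -- rank-`≤ 7` sets have `≤ min 87 (7 + d)` points, rank-`≤ 6` sets `≤ min 43 (6 + d)`
  have hflat : ∀ X ⊆ M.E, M.eRk X ≤ 7 → X.ncard ≤ min 87 (7 + d) :=
    fun X hX hr => le_min (Explicit.ncard_le_eightyseven_of_free M hfree X hX hr) (hcap X hX 7 hr)
  have hflat' : ∀ X ⊆ M.E, M.eRk X ≤ ((7 - 1 : ℕ) : ℕ∞) → X.ncard ≤ min 43 (6 + d) :=
    fun X hX hr => le_min (ncard_le_fortythree_of_eRk_le_six_of_free M hfree hX (by simpa using hr))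
      (hcap X hX 6 (by simpa using hr))
  -- (U)
  have hU1 := Matroid.topCount_le_ncard_compl (M := M) hR hd 7
  have hsum := Matroid.ncard_eRk_eq_ncard_le_le_sum (M := M) 7 d
  have hmul := fun m => Matroid.ncard_eRk_eq_ncard_eq_mul_le M 7 (min 87 (7 + d)) (min 43 (6 + d))
    (by norm_num) hcirc hflat hflat' hd m
  have hC1 : ∀ L ⊆ M.E, M.eRk L = 2 → L.ncard ≤ 3 :=
    fun L hL hr => ncard_le_three_of_eRk_two M hs hfree hL hr
  have hs3 : {C | M.IsCircuit C ∧ C.ncard = 3}.ncard ≤ d * (d + 1) / 2 := by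
    have hT : 2 * {C | M.IsCircuit C ∧ C.ncard = 3}.ncard ≤ d * (d + 1) := S1.two_mul_ncard_triangles_le M hC1 hd
    omega
  have hC2 : ∀ P ⊆ M.E, M.eRk P ≤ 3 → P.ncard ≤ 6 :=
    fun P hP hr => ncard_le_six_of_eRk_le_three_of_free M hfree hP hr
  have hC1' : ∀ L ⊆ M.E, M.eRk L ≤ 2 → L.ncard ≤ 3 := by
    intro L hL' hr
    have := ncard_add_one_le_two_pow_of_eRk_le M hL hfree 2 L hL' hr
    omega
  have hs4 : {C | M.IsCircuit C ∧ C.ncard = 4}.ncard ≤ d * (d + 1) * (d + 2) / 3 := by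
    have hT4 : 3 * {C : Set α | M.IsCircuit C ∧ C.ncard = 4}.ncard ≤ d * (d + 1) * (d + 2) :=
      S1.three_mul_ncard_four_circuits_le M hC1' hC2 hd
    omega
  have hs5 : {C | M.IsCircuit C ∧ C.ncard = 5}.ncard ≤ (d + 4).choose 5 :=
    Matroid.ncard_circuits_le_choose_of_encard M hd 4
  have hs6 : {C | M.IsCircuit C ∧ C.ncard = 6}.ncard ≤ (d + 5).choose 6 :=
    Matroid.ncard_circuits_le_choose_of_encard M hd 5
  have hs7 : {C | M.IsCircuit C ∧ C.ncard = 7}.ncard ≤ (d + 6).choose 7 :=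
    Matroid.ncard_circuits_le_choose_of_encard M hd 6
  have hs8 : {C | M.IsCircuit C ∧ C.ncard = 8}.ncard ≤ (d + 7).choose 8 :=
    Matroid.ncard_circuits_le_choose_of_encard M hd 7
  -- the two pair sums, bounded
  set A : ℕ := ∑ k ∈ Finset.Icc 3 (7 + 1), {C | M.IsCircuit C ∧ C.ncard = k}.ncard * M.E.ncard.choose (7 + 1 - k)
    with hAdef
  set B : ℕ := ∑ k ∈ Finset.Icc 3 (7 + 1), {C | M.IsCircuit C ∧ C.ncard = k}.ncard * ((7 + 1) * d).choose (7 + 1 - k)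
    with hBdef
  have hA : A ≤ d * (d + 1) / 2 * (p + d).choose 5 + d * (d + 1) * (d + 2) / 3 * (p + d).choose 4 +
      (d + 4).choose 5 * (p + d).choose 3 + (d + 5).choose 6 * (p + d).choose 2 + (d + 6).choose 7 * (p + d) +
      (d + 7).choose 8 := by
    rw [hAdef, Explicit.sum_Icc_three_eight, hn]
    simp only [show (7 : ℕ) + 1 - 3 = 5 from rfl, show (7 : ℕ) + 1 - 4 = 4 from rfl,
      show (7 : ℕ) + 1 - 5 = 3 from rfl, show (7 : ℕ) + 1 - 6 = 2 from rfl,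
      show (7 : ℕ) + 1 - 7 = 1 from rfl, show (7 : ℕ) + 1 - 8 = 0 from rfl, Nat.choose_one_right,
      Nat.choose_zero_right, mul_one]
    gcongr
  have hB : B ≤ d * (d + 1) / 2 * (8 * d).choose 5 + d * (d + 1) * (d + 2) / 3 * (8 * d).choose 4 +
      (d + 4).choose 5 * (8 * d).choose 3 + (d + 5).choose 6 * (8 * d).choose 2 + (d + 6).choose 7 * (8 * d) +
      (d + 7).choose 8 := by
    rw [hBdef, Explicit.sum_Icc_three_eight]
    simp only [show (7 : ℕ) + 1 - 3 = 5 from rfl, show (7 : ℕ) + 1 - 4 = 4 from rfl,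
      show (7 : ℕ) + 1 - 5 = 3 from rfl, show (7 : ℕ) + 1 - 6 = 2 from rfl,
      show (7 : ℕ) + 1 - 7 = 1 from rfl, show (7 : ℕ) + 1 - 8 = 0 from rfl, Nat.choose_one_right,
      Nat.choose_zero_right, mul_one, show (7 : ℕ) + 1 = 8 from rfl]
    gcongr
  -- the level counts in `ℚ`, weighted
  have hlevel : ∀ m ∈ Finset.Icc 8 d, ({X : Set α | X ⊆ M.E ∧ M.eRk X = 7 ∧ X.ncard = m}.ncard : ℚ) ≤
      (((min 43 (6 + d) - 7).choose (m - 8) : ℚ) * (A : ℚ) + ((min 87 (7 + d) - 8).choose (m - 8) : ℚ) * (B : ℚ)) /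
        ((m - 7 : ℕ) : ℚ) := by
    intro m hm
    rw [Finset.mem_Icc] at hm
    have hpos : (0 : ℚ) < ((m - 7 : ℕ) : ℚ) := by exact_mod_cast (by omega : 0 < m - 7)
    rw [le_div_iff₀ hpos]
    have h := hmul m
    simp only [show (7 : ℕ) + 1 = 8 from rfl] at h
    have h' : (((m - 7) * {X : Set α | X ⊆ M.E ∧ M.eRk X = 7 ∧ X.ncard = m}.ncard : ℕ) : ℚ) ≤
        (((min 43 (6 + d) - 7).choose (m - 8) * A + (min 87 (7 + d) - 8).choose (m - 8) * B : ℕ) : ℚ) := by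
      exact_mod_cast h
    push_cast at h'
    linarith
  have hre : ∑ m ∈ Finset.Icc 8 d,
      (((min 43 (6 + d) - 7).choose (m - 8) : ℚ) * (A : ℚ) + ((min 87 (7 + d) - 8).choose (m - 8) : ℚ) * (B : ℚ)) /
        ((m - 7 : ℕ) : ℚ) =
      ∑ j ∈ Finset.range (d - 7),
      (((min 43 (6 + d) - 7).choose j : ℚ) * (A : ℚ) + ((min 87 (7 + d) - 8).choose j : ℚ) * (B : ℚ)) / ((j : ℚ) + 1) := by
    rw [show Finset.Icc 8 d = Finset.image (fun j => 8 + j) (Finset.range (d - 7)) from ?_]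
    · rw [Finset.sum_image (fun a _ b _ h => by omega)]
      apply Finset.sum_congr rfl
      intro j _
      rw [show 8 + j - 8 = j by omega, show 8 + j - 7 = j + 1 by omega]
      push_cast
      ring
    · ext m
      rw [Finset.mem_Icc, Finset.mem_image]
      constructor
      · intro hm
        exact ⟨m - 8, by rw [Finset.mem_range]; omega, by omega⟩
      · rintro ⟨j, hj, rfl⟩
        rw [Finset.mem_range] at hj
        omega
  have hrange : Finset.range (d - 7) ⊆ Finset.range (d - 8 + 1) := Finset.range_mono (by omega)
  have hUq : (Matroid.topCount M p 7 : ℚ) ≤ ((p + d).choose 7 : ℚ) +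
      (((∑ j ∈ Finset.range (d - 8 + 1), ((Nat.choose (min 43 (6 + d) - 7) j : ℕ) : ℚ) / ((j : ℚ) + 1)) *
        (((d * (d + 1) / 2 : ℕ) : ℚ) * ((p + d).choose 5 : ℚ) + ((d * (d + 1) * (d + 2) / 3 : ℕ) : ℚ) * ((p + d).choose 4 : ℚ) +
          (((d + 4).choose 5 : ℕ) : ℚ) * ((p + d).choose 3 : ℚ) + (((d + 5).choose 6 : ℕ) : ℚ) * ((p + d).choose 2 : ℚ) +
          (((d + 6).choose 7 : ℕ) : ℚ) * (p + d : ℚ) + (((d + 7).choose 8 : ℕ) : ℚ)) +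
      (∑ j ∈ Finset.range (d - 8 + 1), ((Nat.choose (min 87 (7 + d) - 8) j : ℕ) : ℚ) / ((j : ℚ) + 1)) *
        (((d * (d + 1) / 2 : ℕ) : ℚ) * ((8 * d).choose 5 : ℚ) + ((d * (d + 1) * (d + 2) / 3 : ℕ) : ℚ) * ((8 * d).choose 4 : ℚ) +
          (((d + 4).choose 5 : ℕ) : ℚ) * ((8 * d).choose 3 : ℚ) + (((d + 5).choose 6 : ℕ) : ℚ) * ((8 * d).choose 2 : ℚ) +
          (((d + 6).choose 7 : ℕ) : ℚ) * (8 * d : ℚ) + (((d + 7).choose 8 : ℕ) : ℚ)))) := by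
    have h1 : (Matroid.topCount M p 7 : ℚ) ≤ ((p + d).choose 7 : ℚ) +
        ∑ m ∈ Finset.Icc 8 d, ({X : Set α | X ⊆ M.E ∧ M.eRk X = 7 ∧ X.ncard = m}.ncard : ℚ) := by
      have := hU1.trans hsum
      rw [hn] at this
      simp only [show (7 : ℕ) + 1 = 8 from rfl] at this
      exact_mod_cast this
    have hAq : (A : ℚ) ≤ (((d * (d + 1) / 2 : ℕ) : ℚ) * ((p + d).choose 5 : ℚ) + ((d * (d + 1) * (d + 2) / 3 : ℕ) : ℚ) * ((p + d).choose 4 : ℚ) +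
          (((d + 4).choose 5 : ℕ) : ℚ) * ((p + d).choose 3 : ℚ) + (((d + 5).choose 6 : ℕ) : ℚ) * ((p + d).choose 2 : ℚ) +
          (((d + 6).choose 7 : ℕ) : ℚ) * (p + d : ℚ) + (((d + 7).choose 8 : ℕ) : ℚ)) := by exact_mod_cast hA
    have hBq : (B : ℚ) ≤ (((d * (d + 1) / 2 : ℕ) : ℚ) * ((8 * d).choose 5 : ℚ) + ((d * (d + 1) * (d + 2) / 3 : ℕ) : ℚ) * ((8 * d).choose 4 : ℚ) +
          (((d + 4).choose 5 : ℕ) : ℚ) * ((8 * d).choose 3 : ℚ) + (((d + 5).choose 6 : ℕ) : ℚ) * ((8 * d).choose 2 : ℚ) +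
          (((d + 6).choose 7 : ℕ) : ℚ) * (8 * d : ℚ) + (((d + 7).choose 8 : ℕ) : ℚ)) := by exact_mod_cast hB
    have hσs0 : (0 : ℚ) ≤ ∑ j ∈ Finset.range (d - 8 + 1), ((Nat.choose (min 43 (6 + d) - 7) j : ℕ) : ℚ) / ((j : ℚ) + 1) :=
      Finset.sum_nonneg (fun j _ => by positivity)
    have hσ0 : (0 : ℚ) ≤ ∑ j ∈ Finset.range (d - 8 + 1), ((Nat.choose (min 87 (7 + d) - 8) j : ℕ) : ℚ) / ((j : ℚ) + 1) :=
      Finset.sum_nonneg (fun j _ => by positivity)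
    have h2 : ∑ m ∈ Finset.Icc 8 d, ({X : Set α | X ⊆ M.E ∧ M.eRk X = 7 ∧ X.ncard = m}.ncard : ℚ) ≤
        (∑ j ∈ Finset.range (d - 8 + 1), ((Nat.choose (min 43 (6 + d) - 7) j : ℕ) : ℚ) / ((j : ℚ) + 1)) * (A : ℚ) +
        (∑ j ∈ Finset.range (d - 8 + 1), ((Nat.choose (min 87 (7 + d) - 8) j : ℕ) : ℚ) / ((j : ℚ) + 1)) * (B : ℚ) := by
      rw [Finset.sum_mul, Finset.sum_mul, ← Finset.sum_add_distrib]
      refine (Finset.sum_le_sum hlevel).trans (hre.le.trans ?_)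
      refine Finset.sum_le_sum_of_subset_of_nonneg hrange (fun j _ _ => by positivity) |>.trans' ?_
      apply le_of_eq
      apply Finset.sum_congr rfl
      intro j _
      field_simp
    have e1 := mul_le_mul_of_nonneg_left hAq hσs0
    have e2 := mul_le_mul_of_nonneg_left hBq hσ0
    linarith
  -- (Y)
  have hY := Matroid.two_pow_le_midCount_add (M := M) p 7 hR
  have hA : {X : Set α | X ⊆ M.E ∧ M.eRk X ≤ 7}.ncard ≤ ∑ j ∈ Finset.range (87 + 1), (p + d).choose j := by
    calc {X : Set α | X ⊆ M.E ∧ M.eRk X ≤ 7}.ncard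
        ≤ {X : Set α | X ⊆ (M.ground_finite.toFinset : Set α) ∧ X.ncard ≤ 87}.ncard := by
          apply ncard_le_ncard
          · intro X hX
            exact ⟨by rw [Set.Finite.coe_toFinset]; exact hX.1, (hflat X hX.1 hX.2).trans (min_le_left _ _)⟩
          · exact (Finset.finite_toSet _).finite_subsets.subset (fun X hX => hX.1)
      _ ≤ ∑ j ∈ Finset.range (87 + 1), M.ground_finite.toFinset.card.choose j :=
          ncard_subsets_ncard_le _ 87
      _ = ∑ j ∈ Finset.range (87 + 1), (p + d).choose j := by rw [hEcard]
  have hB := Matroid.ncard_spanning_le (M := M) hd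
  rw [hEcard] at hY hB
  -- the tails: `16·Σ_{j ≤ 95} C(n, j) ≤ 2^n` for `n ≥ 290`
  have hT : 16 * ∑ j ∈ Finset.range (95 + 1), (p + d).choose j ≤ 2 ^ (p + d) :=
    Explicit.sixteen_mul_sum_range_choose_le 95 (p + d) (by omega)
  have hA' : ∑ j ∈ Finset.range (87 + 1), (p + d).choose j ≤ ∑ j ∈ Finset.range (95 + 1), (p + d).choose j :=
    Finset.sum_le_sum_of_subset_of_nonneg (Finset.range_mono (by norm_num)) (fun _ _ _ => Nat.zero_le _)
  have hB' : ∑ j ∈ Finset.range (d + 1), (p + d).choose j ≤ ∑ j ∈ Finset.range (95 + 1), (p + d).choose j :=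
    Finset.sum_le_sum_of_subset_of_nonneg (Finset.range_mono (by omega)) (fun _ _ _ => Nat.zero_le _)
  have hAB : 8 * ({X : Set α | X ⊆ M.E ∧ M.eRk X ≤ 7}.ncard +
      {X : Set α | X ⊆ M.E ∧ M.eRk X = M.eRank}.ncard) ≤ 2 ^ (p + d) := by
    have h1 := hA.trans hA'
    have h2 := hB.trans hB'
    omega
  -- (Φ) and the polynomial inequality
  have hΦ := phiK_le_two_pow_div p 7
  rw [Nat.choose_symm_add] at hΦ
  have hpolyq := level_seven_poly_mult4 d hd8 hd95 p hp
  rw [add_assoc] at hpolyq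
  -- assemble in `ℚ`
  rw [RLS_iff]
  have hYq : (2 : ℚ) ^ (p + d) ≤ (Matroid.midCount M p 7 : ℚ) +
      ({X : Set α | X ⊆ M.E ∧ M.eRk X ≤ 7}.ncard : ℚ) +
      ({X : Set α | X ⊆ M.E ∧ M.eRk X = M.eRank}.ncard : ℚ) := by exact_mod_cast hY
  have hABq : 8 * (({X : Set α | X ⊆ M.E ∧ M.eRk X ≤ 7}.ncard : ℚ) +
      ({X : Set α | X ⊆ M.E ∧ M.eRk X = M.eRank}.ncard : ℚ)) ≤ 2 ^ (p + d) := by exact_mod_cast hAB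
  have hU0 : (0 : ℚ) ≤ (Matroid.topCount M p 7 : ℚ) := Nat.cast_nonneg _
  have hd7 : 7 ≤ d := by omega
  exact level_arith (p := p) (d := d) (n := p + d) (q := 7) rfl hd7 hΦ hU0 hUq hYq hABq hpolyq

/-- **THEOREM C₇, CAP + LEMMA T + MULTIPLICITY + LEMMA T4, GIVEN LEVEL `6`**: level `6` for all `p ≥ 650` implies
level `7` for all `p ≥ 651`. -/
theorem c025_seven_of_six_mult4 (h6 : ∀ (M : Matroid α) [M.Finite] (p : ℕ), 650 ≤ p → RLS M p 6) :
    ∀ (M : Matroid α) [M.Finite] (p : ℕ), 651 ≤ p → RLS M p 7 := by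
  intro M _ p hp
  refine rls_succ_large (α := α) 6 7 650 ?_ ?_ ?_ M p hp (by omega)
  · -- level `6` for `p ≥ 650`
    intro M' _ p' hP _
    exact h6 M' p' (by omega)
  · -- corank `≤ 7`: `U = ∅` or Theorem M
    intro M' _ p' _ hn _
    rcases Nat.lt_or_ge M'.E.ncard (p' + 7) with h | h
    · exact RLS_of_ncard_lt M' h
    · exact RLS_of_ncard_eq M' (by omega)
  · -- the core: coranks `8 … 95` by counting, coranks `≥ 96` beyond the flat bound
    intro M' _ p' hP hR hbig _ hfree
    rcases Nat.lt_or_ge M'.E.ncard (p' + 96) with h | h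
    · exact c025_core_seven_bounded_corank_mult4 M' p' (M'.E.ncard - p') hP (by omega) (by omega) hR (by omega) hfree
    · exact c025_core_seven_beyond_ninetyfive M' p' (by omega) hR (by omega) hfree

/-- **THEOREM C₇, CAP + LEMMA T + MULTIPLICITY + LEMMA T4, UNCONDITIONAL OVER THE TREE AS IT STANDS**: every finite
matroid satisfies C-025 at level `7` for every `p ≥ 1226` — night-1's split row `c025_six_large_split` (level `6` for
`p ≥ 1225`) through the wrapper at `P = 1225` with the core theorem (which holds from `p ≥ 650`). The threshold `651`
needs level `6` from `p ≥ 650` (`c025_seven_of_six_mult4`). -/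
theorem c025_seven_large_mult4' (M : Matroid α) [M.Finite] (p : ℕ) (hp : 1226 ≤ p) : RLS M p 7 := by
  refine rls_succ_large (α := α) 6 7 1225 ?_ ?_ ?_ M p hp (by omega)
  · intro M' _ p' hP _
    exact c025_six_large_split M' p' hP
  · intro M' _ p' _ hn _
    rcases Nat.lt_or_ge M'.E.ncard (p' + 7) with h | h
    · exact RLS_of_ncard_lt M' h
    · exact RLS_of_ncard_eq M' (by omega)
  · intro M' _ p' hP hR hbig _ hfree
    rcases Nat.lt_or_ge M'.E.ncard (p' + 96) with h | h
    · exact c025_core_seven_bounded_corank_mult4 M' p' (M'.E.ncard - p') (by omega) (by omega) (by omega) hR (by omega)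
        hfree
    · exact c025_core_seven_beyond_ninetyfive M' p' (by omega) hR (by omega) hfree

/-- **THEOREM C₇ AT `651`, UNCONDITIONAL OVER THE TREE**: level `5` for `p ≥ 175` (night-1's `c025_five_large_split`)
gives level `6` for `p ≥ 469` (p8's `c025_six_of_five_capT`), which feeds the wrapper at `650`. -/
theorem c025_seven_large_mult4'' (M : Matroid α) [M.Finite] (p : ℕ) (hp : 651 ≤ p) : RLS M p 7 :=
  c025_seven_of_six_mult4
    (fun M' _ p' hp' => c025_six_of_five_capT (fun M'' _ p'' hp'' => c025_five_large_split M'' p'' (by omega)) M' p'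
      (by omega)) M p hp

/-- The same in the literal `C025` body: `phiK p 7 · #U(p, 7) ≤ #Y(p, 7)` for every finite matroid and every `p ≥ 651`. -/
theorem c025_seven_large_mult4 (M : Matroid α) [M.Finite] (p : ℕ) (hp : 651 ≤ p) :
    phiK p 7 * ({A : Set α | A ⊆ M.E ∧ M.eRk A = (p : ℕ∞) ∧ M.eRk (M.E \ A) = (7 : ℕ∞)}.ncard : ℚ) ≤
      ({A : Set α | A ⊆ M.E ∧ (7 : ℕ∞) < M.eRk A ∧ M.eRk A < (p : ℕ∞)}.ncard : ℚ) :=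
  c025_seven_large_mult4'' M p hp

end ThmN

end PercRepro
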